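import Literature.NumberTheory.GaloisRepresentations.ProfiniteIntersectionCocycleExtension
import Literature.NumberTheory.GaloisRepresentations.FiniteGroupAveraging
import Literature.NumberTheory.GaloisRepresentations.ContinuousH1TrivialAction
import Mathlib.Topology.Algebra.ClopenNhdofOne
import Mathlib.Topology.Instances.ZMod
import HarnessLib

/-!
# `H¹(N, ℤ/lⁿ) = H²(N, ℤ/lⁿ) = 0` for a profinite group all of whose finite quotients have order prime to `l`

Topic `NumberTheory/GaloisRepresentations`; theorems only (no definition, no named fact).

Let `N` be a profinite group (compact, totally disconnected topological group) such that every open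
normal subgroup has index prime to the prime `l` — i.e. `N` is a pro-`Σ` group for a set of primes
`Σ ∌ l` ("`cd_l(N) = 0`": Serre, *Cohomologie galoisienne*, I §3.3 Cor. 2 to Prop. 14, "pour que
`cd_p(G) = 0` il faut et il suffit que l'ordre de `G` soit premier à `p`"), and let `N` act trivially
on `ℤ/lⁿ`.  Then, on Mathlib's `continuousCohomology`:

* `subsingleton_continuousCohomology_one_zmod_of_coprime_index` — **`H¹(N, ℤ/lⁿ) = 0`**: a
  continuous homomorphism `N → ℤ/lⁿ` has open kernel of index dividing `lⁿ` and prime to `l`;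
* `subsingleton_continuousCohomology_two_zmod_of_coprime_index` — **`H²(N, ℤ/lⁿ) = 0`**: a
  continuous `2`-cocycle with finite values is constant on the cosets of an open normal subgroup `W`
  (uniform local constancy, the tree's `exists_nhds_one_forall_eq'`), hence inflated from the finite
  group `N/W` of order `d` prime to `l`, where the averaging operator `a ↦ d⁻¹ Σ_m a` kills `H²`
  (the tree's `subsingleton_continuousCohomology_two_of_avg_eq`).

This is the input "`H^q(Δ, ℚ_l) = 0` for `Δ` pro-`Σ`, `l ∉ Σ`" (at the finite levels `ℤ/lⁿ`) of the
Leray spectral sequence argument in the proof of [AbsTopI] Thm 2.6 (iii) (S. Mochizuki, *Topics in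
Absolute Anabelian Geometry I*, p. 23).  Classical, undisputed; nothing here bears on [IUTchIII]
Cor. 3.12.

## References
* J.-P. Serre, *Cohomologie galoisienne* (1994) / *Galois Cohomology* (1997), I §2.2 Prop. 8, I §3.3
  Prop. 14 and Cor. 2. [SerreGaloisCohomology1997]
* S. Mochizuki, *Topics in Absolute Anabelian Geometry I: Generalities* (2012), proof of Thm 2.6 (iii),
  p. 23. [MochizukiAbsTopI2012]
-/

noncomputable section

open CategoryTheory Function Topology

namespace Literature.NumberTheory.GaloisRepresentations

open _root_.TopRep _root_.ContRepresentation _root_.ContinuousCohomology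

variable {N : Type} [Group N] [TopologicalSpace N] [IsTopologicalGroup N]
variable (l : ℕ) (n : ℕ)

/-- A natural number dividing `lⁿ` and prime to `l` is `1`. [folklore] -/
private theorem eq_one_of_dvd_pow_of_coprime {d : ℕ} (hd : d ∣ l ^ n) (hcop : d.Coprime l) : d = 1 :=
  Nat.Coprime.eq_one_of_dvd (Nat.Coprime.pow_right n hcop) hd

/-- **`H¹(N, ℤ/lⁿ) = 0`** when every open normal subgroup of the compact group `N` has index prime to
`l` (trivial action): a continuous homomorphism `N → ℤ/lⁿ` has open normal kernel whose index divides
`lⁿ` and is prime to `l`, hence is trivial. [cite: SerreGaloisCohomology1997, I §3.3 Cor. 2] -/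
theorem subsingleton_continuousCohomology_one_zmod_of_coprime_index
    (hcop : ∀ U : Subgroup N, U.Normal → IsOpen (U : Set N) → U.index.Coprime l) :
    Subsingleton (continuousCohomology 1 (ContinuousRep.trivial N ℤ (ZMod (l ^ n))).toTopRep) := by
  set X := (ContinuousRep.trivial N ℤ (ZMod (l ^ n))).toTopRep with hX
  have htriv : ∀ (g : N) (x : X), X.ρ g x = x := fun _ _ => rfl
  refine ⟨fun x y => ?_⟩
  suffices h : ∀ x : continuousCohomology 1 X, x = 0 by rw [h x, h y]
  intro x
  obtain ⟨φ, rfl⟩ := oneCocycleClass_surjective X x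
  have hmul : ∀ g h : N, φ.1 (g * h) = φ.1 g + φ.1 h :=
    contOneCocycles.apply_mul_of_trivial htriv φ
  have h1 : φ.1 1 = 0 := by
    have h := hmul 1 1
    rw [mul_one] at h
    exact left_eq_add.mp h
  -- the homomorphism `N → Multiplicative (ℤ/lⁿ)`
  let f : N →* Multiplicative (ZMod (l ^ n)) :=
    { toFun := fun g => Multiplicative.ofAdd (φ.1 g)
      map_one' := by rw [h1]; rfl
      map_mul' := fun g h => by rw [hmul]; rfl }
  have hker : (f.ker : Set N) = φ.1 ⁻¹' {0} := by
    ext g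
    simp only [SetLike.mem_coe, MonoidHom.mem_ker, Set.mem_preimage, Set.mem_singleton_iff]
    exact Multiplicative.ofAdd.apply_eq_iff_eq (y := (0 : ZMod (l ^ n)))
  have hopen : IsOpen (f.ker : Set N) := by
    rw [hker]
    exact (isOpen_discrete _).preimage φ.1.continuous
  have hidx : f.ker.index = 1 := by
    refine eq_one_of_dvd_pow_of_coprime l n ?_ (hcop f.ker inferInstance hopen)
    rw [Subgroup.index_ker]
    have h := Subgroup.card_subgroup_dvd_card f.range
    rwa [show Nat.card (Multiplicative (ZMod (l ^ n))) = l ^ n from Nat.card_zmod (l ^ n)] at h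
  rw [Subgroup.index_eq_one] at hidx
  have hφ : φ = 0 := by
    apply Subtype.ext
    ext g
    have hg : g ∈ f.ker := hidx ▸ Subgroup.mem_top g
    rw [MonoidHom.mem_ker] at hg
    exact Multiplicative.ofAdd.apply_eq_iff_eq.mp hg
  rw [hφ, oneCocycleClass_zero]

/-- **`H²(N, ℤ/lⁿ) = 0`** when every open normal subgroup of the profinite group `N` has index prime to
`l` (trivial action): a continuous `2`-cocycle is inflated from a finite quotient `N/W` of order prime
to `l`, on which averaging kills `H²`. [cite: SerreGaloisCohomology1997, I §3.3 Cor. 2]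
[cite: MochizukiAbsTopI2012, Thm 2.6 (iii) proof p.23] -/
theorem subsingleton_continuousCohomology_two_zmod_of_coprime_index [Fact l.Prime] [CompactSpace N]
    [T2Space N] [TotallyDisconnectedSpace N]
    (hcop : ∀ U : Subgroup N, U.Normal → IsOpen (U : Set N) → U.index.Coprime l) :
    Subsingleton (continuousCohomology 2 (ContinuousRep.trivial N ℤ (ZMod (l ^ n))).toTopRep) := by
  classical
  set X := (ContinuousRep.trivial N ℤ (ZMod (l ^ n))).toTopRep with hX
  refine ⟨fun x y => ?_⟩
  suffices h : ∀ x : continuousCohomology 2 X, x = 0 by rw [h x, h y]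
  intro x
  obtain ⟨c, rfl⟩ := twoCocycleClass_surjective X x
  -- Step 1: `c` is constant on the cosets of an open normal subgroup `W` (uniform local constancy)
  obtain ⟨V, hV, hVc⟩ := exists_nhds_one_forall_eq' (X := N × N) (P := N × N)
    (fun z v => c.1 (z * v)) (c.1.continuous.comp continuous_mul)
  obtain ⟨V₁, hV₁, V₂, hV₂, hV₁₂⟩ := mem_nhds_prod_iff.1 hV
  have h1 : (1 : N) ∈ interior (V₁ ∩ V₂) := mem_interior_iff_mem_nhds.2 (Filter.inter_mem hV₁ hV₂)
  obtain ⟨W, hW⟩ := ProfiniteGrp.exist_openNormalSubgroup_sub_open_nhds_of_one isOpen_interior h1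
  have hW' : (W : Set N) ⊆ V₁ ∩ V₂ := hW.trans interior_subset
  have hadapt : ∀ s t w w' : N, w ∈ W → w' ∈ W → c.1 (s * w, t * w') = c.1 (s, t) := by
    intro s t w w' hw hw'
    have h := hVc (s, t) (w, w') (hV₁₂ (Set.mk_mem_prod (hW' hw).1 (hW' hw').2))
    rwa [mul_one] at h
  -- Step 2: the finite quotient `Q = N / W`, of order `d` prime to `l`
  haveI hdisc : DiscreteTopology (N ⧸ W.toSubgroup) := QuotientGroup.discreteTopology W.isOpen'
  haveI : Finite (N ⧸ W.toSubgroup) := Subgroup.quotient_finite_of_isOpen W.toSubgroup W.isOpen'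
  letI : Fintype (N ⧸ W.toSubgroup) := Fintype.ofFinite _
  set Q := N ⧸ W.toSubgroup with hQ
  set d : ℕ := Fintype.card Q with hd
  have hdcop : d.Coprime (l ^ n) := by
    refine Nat.Coprime.pow_right n ?_
    have h := hcop W.toSubgroup inferInstance W.isOpen'
    rwa [Subgroup.index_eq_card, Nat.card_eq_fintype_card] at h
  -- Step 3: the descended cocycle on `Q`
  let π : N →* Q := QuotientGroup.mk' W.toSubgroup
  let cbar : Q × Q → ZMod (l ^ n) := fun q => c.1 (q.1.out, q.2.out)
  have hcbar : ∀ s t : N, cbar (π s, π t) = c.1 (s, t) := by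
    intro s t
    obtain ⟨w, hw⟩ := QuotientGroup.mk_out_eq_mul W.toSubgroup s
    obtain ⟨w', hw'⟩ := QuotientGroup.mk_out_eq_mul W.toSubgroup t
    change c.1 (((π s : Q)).out, ((π t : Q)).out) = c.1 (s, t)
    rw [QuotientGroup.mk'_apply, QuotientGroup.mk'_apply, hw, hw']
    exact hadapt s t w w' w.2 w'.2
  set Y := (ContinuousRep.trivial Q ℤ (ZMod (l ^ n))).toTopRep with hY
  have hcbar_mem : (⟨cbar, continuous_of_discreteTopology⟩ : C(Q × Q, ZMod (l ^ n))) ∈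
      contTwoCocycles Y := by
    rw [mem_contTwoCocycles_iff]
    intro q₁ q₂ q₃
    obtain ⟨s₁, rfl⟩ := QuotientGroup.mk'_surjective W.toSubgroup q₁
    obtain ⟨s₂, rfl⟩ := QuotientGroup.mk'_surjective W.toSubgroup q₂
    obtain ⟨s₃, rfl⟩ := QuotientGroup.mk'_surjective W.toSubgroup q₃
    change cbar (π s₂, π s₃) + cbar (π s₁, π s₂ * π s₃) = cbar (π s₁ * π s₂, π s₃) + cbar (π s₁, π s₂)
    rw [← map_mul, ← map_mul, hcbar, hcbar, hcbar, hcbar]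
    exact c.2 s₁ s₂ s₃
  set cbar' : contTwoCocycles Y := ⟨⟨cbar, continuous_of_discreteTopology⟩, hcbar_mem⟩ with hcbar'
  -- Step 4: averaging on the finite group `Q` kills `H²(Q, ℤ/lⁿ)`
  let u : (ZMod (l ^ n))ˣ := ZMod.unitOfCoprime d hdcop
  let lam : ZMod (l ^ n) →+ ZMod (l ^ n) := AddMonoidHom.mulLeft (↑u⁻¹ : ZMod (l ^ n))
  have hlam : ∀ a : ZMod (l ^ n),
      avgFun (ContinuousRep.trivial Q ℤ (ZMod (l ^ n))) lam (fun _ => a) = a := by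
    intro a
    simp only [avgFun, ContinuousRep.trivial_apply, AddMonoidHom.coe_mulLeft, lam,
      Finset.sum_const, Finset.card_univ, nsmul_eq_mul]
    rw [← hd, ← ZMod.coe_unitOfCoprime d hdcop, ← mul_assoc, Units.mul_inv, one_mul]
  haveI := subsingleton_continuousCohomology_two_of_avg_eq
    (ContinuousRep.trivial Q ℤ (ZMod (l ^ n))) lam hlam
  have hzero : twoCocycleClass Y cbar' = 0 := Subsingleton.elim _ _
  -- Step 5: `c` is the inflation of `cbar`
  let θ : N →ₜ* Q := ⟨π, QuotientGroup.continuous_mk⟩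
  let φ : res (θ : N →* Q) Y ⟶ X := TopRep.ofHom ⟨ContinuousLinearMap.id ℤ (ZMod (l ^ n)), fun _ => rfl⟩
  have hpull : contTwoCocycles.pullback θ φ cbar' = c := by
    refine Subtype.ext (ContinuousMap.ext fun q => ?_)
    obtain ⟨s, t⟩ := q
    rw [contTwoCocycles.pullback_apply]
    exact hcbar s t
  have key := map_twoCocycleClass Y θ φ cbar'
  rw [hzero, map_zero, hpull] at key
  exact key.symm

end Literature.NumberTheory.GaloisRepresentations

end
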